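import Summits.Ventures.LatticeQCDFlow.TrivializingMaps.TruncatedFlowAcceptanceFootprint
import Summits.Ventures.LatticeQCDFlow.TrivializingMaps.AcceptanceFootprintSharp

/-!
HONEST FRAMING: exact (Metropolis-corrected) sampling algorithms for lattice gauge theory; figures
of merit are autocorrelation/cost numbers at stated couplings and volumes; no continuum-physics
claim.

# TruncatedFlowAcceptanceFootprintSharp — the acceptance– and ESS–footprint laws of the order-`N`
# flow samplers with theory-1's SHARP dual constant (lean-2 GEN-6, ours)

Venture-side (OURS). Cell `lqcd-flow` (pub-lqcd), unit `pub-lqcd-lean-2-g6`, 2026-08-22.  Composes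
lean-2's `TruncatedFlowAcceptanceFootprint` (|Cov_π| ≤ 6(1−acc)ab + cone tail; ESS form 3√χ·ab + tail)
with theory-1's THEOREM Q♯ file `AcceptanceFootprintSharp` (row 94a: the one-test-function dual bound
with constant `2` in place of `3`).  The one new ingredient is §1: Q♯'s test function
`h = (A − ⟨A⟩_π)(B − ⟨B⟩_ν)` does not need EXACT uncorrelation under the model law `ν` — in general
`⟨h⟩_π − ⟨h⟩_ν = Cov_π(A,B) − Cov_ν(A,B)`, so dual closeness transfers APPROXIMATE clustering with the
sharp constant:

* §1 `abs_cov_sub_cov_le_of_integralClose` — `IntegralClose π ν ε`, `|A| ≤ a`, `|B| ≤ b` measurable ⟹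
  `|Cov_π(A,B) − Cov_ν(A,B)| ≤ ε(ab + max(a|⟨B⟩_ν|, b|⟨A⟩_π|)) ≤ 2εab`
  (`abs_cov_le_two_mul_add_abs_cov_of_integralClose`: `|Cov_π| ≤ 2εab + |Cov_ν|`).
* §2 for Lüscher's order-`N` truncated Wilson-flow samplers (every volume, `t ∈ [0,T]`, observables whose
  `2(N+1)m`-plaquette balls are disjoint, `ε_m(t) = 2n e^{ct}(ct)^m/m!`, `c = coneRate d n B β T N`):
  `truncatedFlow_abs_cov_target_le_two` — any law `ε`-dual-close to the proposal has
  `|Cov| ≤ 2εab + 2(ℓ_A ε_m b + a ℓ_B ε_m)` (tree: `3εab + …`);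
  **`truncatedFlow_abs_cov_boltzmann_le_four_mul_of_meanAccept`** — equilibrium acceptance `≥ acc` ⟹
  `|Cov_π(A,B)| ≤ 4(1−acc)ab + 2(ℓ_A ε_m b + a ℓ_B ε_m)` (tree: `6(1−acc)ab + …`), with the rejection
  floor `1 − acc ≥ (|Cov_π| − tail)/(4ab)`;
  **`truncatedFlow_abs_cov_boltzmann_le_two_sqrt_of_sqWeight`** — `∫ w²q ≤ 1 + χ` ⟹
  `|Cov_π(A,B)| ≤ 2√χ·ab + 2(ℓ_A ε_m b + a ℓ_B ε_m)` (tree: `3√χ·ab + …`).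

By row 94b (`AcceptanceFootprintFloor`) the constant `4` in the acceptance form is optimal among linear
laws.  NOT CLAIMED: any value of `acc`, `χ`, `c` or a correlation at a physical `β`; cost statements.
-/

noncomputable section

namespace Summit.Ventures.LatticeQCDFlow.TrivializingMaps

open MeasureTheory Set
open Literature.MathematicalPhysics.QuantumFieldTheory
open Literature.MathematicalPhysics.QuantumFieldTheory.Luscher2010
open Literature.MathematicalPhysics.QuantumFieldTheory.WilsonFlow (coeConfig)
open scoped Matrix Matrix.Norms.Frobenius Nat ContDiff

/-! ## §1 Dual closeness transfers approximate clustering with the sharp constant -/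

section Dual

variable {Ω : Type*} [MeasurableSpace Ω]

/-- **`|Cov_π(A,B) − Cov_ν(A,B)| ≤ ε(ab + max(a|⟨B⟩_ν|, b|⟨A⟩_π|))`** for `IntegralClose π ν ε` and bounded
measurable `A`, `B` — theory-1's one-test-function bound WITHOUT the exact-uncorrelation hypothesis
(`h = (A − ⟨A⟩_π)(B − ⟨B⟩_ν)` has `⟨h⟩_π − ⟨h⟩_ν = Cov_π − Cov_ν`). [ours] -/
theorem abs_cov_sub_cov_le_of_integralClose (π ν : Measure Ω) [IsProbabilityMeasure π]
    [IsProbabilityMeasure ν] {ε : ℝ} (hclose : IntegralClose π ν ε) {A B : Ω → ℝ}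
    (hAm : Measurable A) (hBm : Measurable B) {a b : ℝ} (hA : ∀ x, |A x| ≤ a)
    (hB : ∀ x, |B x| ≤ b) :
    |(∫ x, A x * B x ∂π - (∫ x, A x ∂π) * ∫ x, B x ∂π)
        - (∫ x, A x * B x ∂ν - (∫ x, A x ∂ν) * ∫ x, B x ∂ν)|
      ≤ ε * (a * b + max (a * |∫ x, B x ∂ν|) (b * |∫ x, A x ∂π|)) := by
  obtain ⟨x₀⟩ : Nonempty Ω := nonempty_of_isProbabilityMeasure π
  set s₀ := ∫ x, A x ∂π with hs₀def
  set t₀ := ∫ x, B x ∂ν with ht₀def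
  have hs₀ : |s₀| ≤ a := covTest_abs_integral_le π hA
  have ht₀ : |t₀| ≤ b := covTest_abs_integral_le ν hB
  set c := s₀ * t₀ + (|a * t₀ + b * s₀| - |a * t₀ - b * s₀|) / 2 with hcdef
  set w := a * b + max (a * |t₀|) (b * |s₀|) with hwdef
  have hhm : Measurable fun x => (A x - s₀) * (B x - t₀) - c :=
    ((hAm.sub measurable_const).mul (hBm.sub measurable_const)).sub measurable_const
  have hhb : ∀ x, |(A x - s₀) * (B x - t₀) - c| ≤ w :=
    fun x => Sharp.abs_mul_sub_mul_sub_sub_le (hA x) hs₀ (hB x) ht₀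
  have hw : 0 ≤ w := (abs_nonneg _).trans (hhb x₀)
  have key := hclose _ w hhm hw hhb
  rw [integral_mul_sub_mul_sub_sub π hAm hBm hA hB, integral_mul_sub_mul_sub_sub ν hAm hBm hA hB,
    ← hs₀def, ← ht₀def] at key
  have e : ∫ x, A x * B x ∂π - s₀ * ∫ x, B x ∂π - t₀ * s₀ + (s₀ * t₀ - c)
      - (∫ x, A x * B x ∂ν - s₀ * t₀ - t₀ * ∫ x, A x ∂ν + (s₀ * t₀ - c))
      = (∫ x, A x * B x ∂π - s₀ * ∫ x, B x ∂π)
        - (∫ x, A x * B x ∂ν - (∫ x, A x ∂ν) * t₀) := by ring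
  rwa [e] at key

/-- **`|Cov_π(A,B)| ≤ 2εab + |Cov_ν(A,B)|`**: dual closeness transfers APPROXIMATE clustering of the
model law with the sharp constant `2` (the tree's `abs_sub_mul_le_three_add` route gives `3`). [ours] -/
theorem abs_cov_le_two_mul_add_abs_cov_of_integralClose (π ν : Measure Ω)
    [IsProbabilityMeasure π] [IsProbabilityMeasure ν] {ε : ℝ} (hclose : IntegralClose π ν ε) {A B : Ω → ℝ}
    (hAm : Measurable A) (hBm : Measurable B) {a b : ℝ} (hA : ∀ x, |A x| ≤ a)
    (hB : ∀ x, |B x| ≤ b) :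
    |∫ x, A x * B x ∂π - (∫ x, A x ∂π) * ∫ x, B x ∂π|
      ≤ 2 * ε * (a * b) + |∫ x, A x * B x ∂ν - (∫ x, A x ∂ν) * ∫ x, B x ∂ν| := by
  obtain ⟨x₀⟩ : Nonempty Ω := nonempty_of_isProbabilityMeasure π
  have ha : 0 ≤ a := (abs_nonneg _).trans (hA x₀)
  have hb : 0 ≤ b := (abs_nonneg _).trans (hB x₀)
  have h := abs_cov_sub_cov_le_of_integralClose π ν hclose hAm hBm hA hB
  have hm := Sharp.max_le_mul (covTest_abs_integral_le π hA) (covTest_abs_integral_le ν hB) ha hb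
  have hε := hclose.nonneg
  have h3 := abs_sub_abs_le_abs_sub (∫ x, A x * B x ∂π - (∫ x, A x ∂π) * ∫ x, B x ∂π)
    (∫ x, A x * B x ∂ν - (∫ x, A x ∂ν) * ∫ x, B x ∂ν)
  nlinarith [mul_le_mul_of_nonneg_left hm hε]

end Dual

/-! ## §2 The order-`N` flow samplers with the sharp constant -/

section Flow

variable {d L n : ℕ} [NeZero L]

/-- **EXPRESSIVITY BARRIER, sharp dual constant**: a law `ε`-dual-close to the order-`N` flow proposal
`(Φ_t)_* D[V]` has `|Cov(A,B)| ≤ 2εab + 2(ℓ_A ε_m b + a ℓ_B ε_m)` for observables whose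
`2(N+1)m`-balls are disjoint (tree `truncatedFlow_abs_cov_target_le`: `3εab + …`). [ours] -/
theorem truncatedFlow_abs_cov_target_le_two (hn : n ≠ 0) (B : SuBasis n) (β : ℝ) (N : ℕ) {T : ℝ}
    (hT : 0 ≤ T) {Sk : ℕ → AmbConfig d L n → ℝ} {c : ℕ → ℝ} (hsm : ∀ k, ContDiff ℝ ∞ (Sk k))
    (hser : IsLuscherSeries B (fun W => β * ambWilsonAction W) Sk c)
    {Φ : ℝ → GaugeConfig d L (Matrix.specialUnitaryGroup (Fin n) ℂ) →
      GaugeConfig d L (Matrix.specialUnitaryGroup (Fin n) ℂ)}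
    (hΦ : IsFlowMap (fun t W => -linkGrad B (truncFlowAction Sk t N) W) Φ)
    {t : ℝ} (ht : t ∈ Set.Icc 0 T) (hΦm : Measurable (Φ t)) (m : ℕ)
    (ν : Measure (GaugeConfig d L (Matrix.specialUnitaryGroup (Fin n) ℂ))) [IsProbabilityMeasure ν]
    {ε : ℝ} (hclose : IntegralClose ν
      ((trivialMeasure (Matrix.specialUnitaryGroup (Fin n) ℂ) d L).map (Φ t)) ε)
    {A Bo : GaugeConfig d L (Matrix.specialUnitaryGroup (Fin n) ℂ) → ℝ}
    (hAm : Measurable A) (hBm : Measurable Bo) {a b : ℝ} (hAa : ∀ U, |A U| ≤ a)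
    (hBb : ∀ U, |Bo U| ≤ b) {S T' : Set (Edge d L)} (hA : DependsOn A S) (hB : DependsOn Bo T')
    {ℓA ℓB : ℝ}
    (hAlip : ∀ (U U' : GaugeConfig d L (Matrix.specialUnitaryGroup (Fin n) ℂ)) (η : ℝ),
      (∀ e ∈ S, ‖coeConfig U e - coeConfig U' e‖ ≤ η) → |A U - A U'| ≤ ℓA * η)
    (hBlip : ∀ (U U' : GaugeConfig d L (Matrix.specialUnitaryGroup (Fin n) ℂ)) (η : ℝ),
      (∀ e ∈ T', ‖coeConfig U e - coeConfig U' e‖ ≤ η) → |Bo U - Bo U'| ≤ ℓB * η)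
    (hsep : ∀ e ∈ S, ∀ e' ∈ T',
      Disjoint (linkBall (2 * (N + 1) * m) e) (linkBall (2 * (N + 1) * m) e')) :
    |∫ U, A U * Bo U ∂ν - (∫ U, A U ∂ν) * ∫ U, Bo U ∂ν| ≤
      2 * ε * (a * b) +
        2 * (ℓA * (2 * n * Real.exp (coneRate d n B β T N * t) *
            (coneRate d n B β T N * t) ^ m / (m ! : ℝ)) * b +
          a * (ℓB * (2 * n * Real.exp (coneRate d n B β T N * t) *
            (coneRate d n B β T N * t) ^ m / (m ! : ℝ)))) := by
  haveI : IsProbabilityMeasure (trivialMeasure (Matrix.specialUnitaryGroup (Fin n) ℂ) d L) := by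
    unfold trivialMeasure; infer_instance
  haveI : IsProbabilityMeasure
      ((trivialMeasure (Matrix.specialUnitaryGroup (Fin n) ℂ) d L).map (Φ t)) :=
    Measure.isProbabilityMeasure_map hΦm.aemeasurable
  have hfac := truncatedFlow_abs_cov_le hn B β N hT hsm hser hΦ ht hΦm m hAm hBm hAa hBb hA hB
    hAlip hBlip hsep
  have h := abs_cov_le_two_mul_add_abs_cov_of_integralClose ν _ hclose hAm hBm hAa hBb
  linarith

/-- **ACCEPTANCE–FOOTPRINT LAW FOR THE ORDER-`N` FLOW SAMPLERS WITH THE SHARP CONSTANT `4`, EVERY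
VOLUME.**  Setting of the tree's `truncatedFlow_abs_cov_boltzmann_le_of_meanAccept` (continuous action
`S`, target `𝒵⁻¹e^{-S}D[U]`, proposal `(Φ_t)_* D[V]` with density `q`, equilibrium acceptance `≥ acc`,
observables with disjoint `2(N+1)m`-balls): `|Cov_π(A,B)| ≤ 4(1−acc)ab + 2(ℓ_A ε_m b + a ℓ_B ε_m)`.
[ours; the constant `4` is theory-1's THEOREM Q♯ and is optimal among linear laws by row 94b] -/
theorem truncatedFlow_abs_cov_boltzmann_le_four_mul_of_meanAccept (hn : n ≠ 0) (B : SuBasis n)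
    (β : ℝ) (N : ℕ) {T : ℝ} (hT : 0 ≤ T) {Sk : ℕ → AmbConfig d L n → ℝ} {c : ℕ → ℝ}
    (hsm : ∀ k, ContDiff ℝ ∞ (Sk k)) (hser : IsLuscherSeries B (fun W => β * ambWilsonAction W) Sk c)
    {Φ : ℝ → GaugeConfig d L (Matrix.specialUnitaryGroup (Fin n) ℂ) →
      GaugeConfig d L (Matrix.specialUnitaryGroup (Fin n) ℂ)}
    (hΦ : IsFlowMap (fun t W => -linkGrad B (truncFlowAction Sk t N) W) Φ)
    {t : ℝ} (ht : t ∈ Set.Icc 0 T) (hΦm : Measurable (Φ t))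
    {S : GaugeConfig d L (Matrix.specialUnitaryGroup (Fin n) ℂ) → ℝ} (hS : Continuous S)
    {q : GaugeConfig d L (Matrix.specialUnitaryGroup (Fin n) ℂ) → ℝ} (hq0 : ∀ U, 0 ≤ q U)
    (hqm : Measurable q)
    (hν : (trivialMeasure (Matrix.specialUnitaryGroup (Fin n) ℂ) d L).map (Φ t)
      = (trivialMeasure (Matrix.specialUnitaryGroup (Fin n) ℂ) d L).withDensity
          fun U => ENNReal.ofReal (q U))
    {acc : ℝ}
    (hacc : acc ≤ ∫ U, ∫ U', min (Real.exp (-S U) / (partitionFn S).toReal * q U')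
        (Real.exp (-S U') / (partitionFn S).toReal * q U)
        ∂(trivialMeasure (Matrix.specialUnitaryGroup (Fin n) ℂ) d L)
        ∂(trivialMeasure (Matrix.specialUnitaryGroup (Fin n) ℂ) d L))
    (m : ℕ) {A Bo : GaugeConfig d L (Matrix.specialUnitaryGroup (Fin n) ℂ) → ℝ}
    (hAm : Measurable A) (hBm : Measurable Bo) {a b : ℝ} (hAa : ∀ U, |A U| ≤ a)
    (hBb : ∀ U, |Bo U| ≤ b) {SA SB : Set (Edge d L)} (hA : DependsOn A SA) (hB : DependsOn Bo SB)
    {ℓA ℓB : ℝ}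
    (hAlip : ∀ (U U' : GaugeConfig d L (Matrix.specialUnitaryGroup (Fin n) ℂ)) (η : ℝ),
      (∀ e ∈ SA, ‖coeConfig U e - coeConfig U' e‖ ≤ η) → |A U - A U'| ≤ ℓA * η)
    (hBlip : ∀ (U U' : GaugeConfig d L (Matrix.specialUnitaryGroup (Fin n) ℂ)) (η : ℝ),
      (∀ e ∈ SB, ‖coeConfig U e - coeConfig U' e‖ ≤ η) → |Bo U - Bo U'| ≤ ℓB * η)
    (hsep : ∀ e ∈ SA, ∀ e' ∈ SB,
      Disjoint (linkBall (2 * (N + 1) * m) e) (linkBall (2 * (N + 1) * m) e')) :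
    |∫ U, A U * Bo U ∂(boltzmannMeasure S) -
        (∫ U, A U ∂(boltzmannMeasure S)) * ∫ U, Bo U ∂(boltzmannMeasure S)| ≤
      4 * (1 - acc) * (a * b) +
        2 * (ℓA * (2 * n * Real.exp (coneRate d n B β T N * t) *
            (coneRate d n B β T N * t) ^ m / (m ! : ℝ)) * b +
          a * (ℓB * (2 * n * Real.exp (coneRate d n B β T N * t) *
            (coneRate d n B β T N * t) ^ m / (m ! : ℝ)))) := by
  obtain ⟨hp0, hpm, hpi, hp1⟩ := Gauge.density_boltzmann_spec (d := d) (L := L) hS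
  obtain ⟨hqi, hq1⟩ := Gauge.integrable_of_map_eq_withDensity (d := d) (L := L) hΦm hq0 hqm hν
  haveI : IsProbabilityMeasure (boltzmannMeasure S) := by
    rw [Gauge.boltzmannMeasure_eq_withDensity hS]
    exact isProbabilityMeasure_withDensity_ofReal hp0 hpi hp1
  have hclose : IntegralClose (boltzmannMeasure S)
      ((trivialMeasure (Matrix.specialUnitaryGroup (Fin n) ℂ) d L).map (Φ t)) (2 * (1 - acc)) := by
    rw [Gauge.boltzmannMeasure_eq_withDensity hS, hν]
    unfold trivialMeasure at hpi hp1 hqi hq1 hacc ⊢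
    exact integralClose_of_meanAccept hp0 hpm hpi hp1 hq0 hqm hqi hq1 hacc
  have h := truncatedFlow_abs_cov_target_le_two hn B β N hT hsm hser hΦ ht hΦm m (boltzmannMeasure S)
    hclose hAm hBm hAa hBb hA hB hAlip hBlip hsep
  linarith

/-- **REJECTION FLOOR, sharp constant**: under the same hypotheses with `0 < a`, `0 < b`,
`1 − acc ≥ (|Cov_π(A,B)| − 2(ℓ_A ε_m b + a ℓ_B ε_m)) / (4ab)` — every volume. [ours] -/
theorem truncatedFlow_one_sub_meanAccept_ge_four (hn : n ≠ 0) (B : SuBasis n) (β : ℝ) (N : ℕ)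
    {T : ℝ} (hT : 0 ≤ T) {Sk : ℕ → AmbConfig d L n → ℝ} {c : ℕ → ℝ}
    (hsm : ∀ k, ContDiff ℝ ∞ (Sk k)) (hser : IsLuscherSeries B (fun W => β * ambWilsonAction W) Sk c)
    {Φ : ℝ → GaugeConfig d L (Matrix.specialUnitaryGroup (Fin n) ℂ) →
      GaugeConfig d L (Matrix.specialUnitaryGroup (Fin n) ℂ)}
    (hΦ : IsFlowMap (fun t W => -linkGrad B (truncFlowAction Sk t N) W) Φ)
    {t : ℝ} (ht : t ∈ Set.Icc 0 T) (hΦm : Measurable (Φ t))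
    {S : GaugeConfig d L (Matrix.specialUnitaryGroup (Fin n) ℂ) → ℝ} (hS : Continuous S)
    {q : GaugeConfig d L (Matrix.specialUnitaryGroup (Fin n) ℂ) → ℝ} (hq0 : ∀ U, 0 ≤ q U)
    (hqm : Measurable q)
    (hν : (trivialMeasure (Matrix.specialUnitaryGroup (Fin n) ℂ) d L).map (Φ t)
      = (trivialMeasure (Matrix.specialUnitaryGroup (Fin n) ℂ) d L).withDensity
          fun U => ENNReal.ofReal (q U))
    {acc : ℝ}
    (hacc : acc ≤ ∫ U, ∫ U', min (Real.exp (-S U) / (partitionFn S).toReal * q U')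
        (Real.exp (-S U') / (partitionFn S).toReal * q U)
        ∂(trivialMeasure (Matrix.specialUnitaryGroup (Fin n) ℂ) d L)
        ∂(trivialMeasure (Matrix.specialUnitaryGroup (Fin n) ℂ) d L))
    (m : ℕ) {A Bo : GaugeConfig d L (Matrix.specialUnitaryGroup (Fin n) ℂ) → ℝ}
    (hAm : Measurable A) (hBm : Measurable Bo) {a b : ℝ} (ha : 0 < a) (hb : 0 < b)
    (hAa : ∀ U, |A U| ≤ a) (hBb : ∀ U, |Bo U| ≤ b)
    {SA SB : Set (Edge d L)} (hA : DependsOn A SA) (hB : DependsOn Bo SB) {ℓA ℓB : ℝ}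
    (hAlip : ∀ (U U' : GaugeConfig d L (Matrix.specialUnitaryGroup (Fin n) ℂ)) (η : ℝ),
      (∀ e ∈ SA, ‖coeConfig U e - coeConfig U' e‖ ≤ η) → |A U - A U'| ≤ ℓA * η)
    (hBlip : ∀ (U U' : GaugeConfig d L (Matrix.specialUnitaryGroup (Fin n) ℂ)) (η : ℝ),
      (∀ e ∈ SB, ‖coeConfig U e - coeConfig U' e‖ ≤ η) → |Bo U - Bo U'| ≤ ℓB * η)
    (hsep : ∀ e ∈ SA, ∀ e' ∈ SB,
      Disjoint (linkBall (2 * (N + 1) * m) e) (linkBall (2 * (N + 1) * m) e')) :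
    (|∫ U, A U * Bo U ∂(boltzmannMeasure S) -
        (∫ U, A U ∂(boltzmannMeasure S)) * ∫ U, Bo U ∂(boltzmannMeasure S)| -
      2 * (ℓA * (2 * n * Real.exp (coneRate d n B β T N * t) *
            (coneRate d n B β T N * t) ^ m / (m ! : ℝ)) * b +
          a * (ℓB * (2 * n * Real.exp (coneRate d n B β T N * t) *
            (coneRate d n B β T N * t) ^ m / (m ! : ℝ))))) / (4 * (a * b)) ≤ 1 - acc := by
  have h := truncatedFlow_abs_cov_boltzmann_le_four_mul_of_meanAccept hn B β N hT hsm hser hΦ ht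
    hΦm hS hq0 hqm hν hacc m hAm hBm hAa hBb hA hB hAlip hBlip hsep
  have hab : 0 < 4 * (a * b) := by positivity
  rw [div_le_iff₀ hab]
  linarith

/-- **ESS–FOOTPRINT LAW FOR THE ORDER-`N` FLOW SAMPLERS WITH THE SHARP CONSTANT `2`, EVERY VOLUME.**
Setting of the tree's `truncatedFlow_abs_cov_boltzmann_le_of_sqWeight` (`e^{-S}/𝒵 = w·q`,
`∫ w²q D[U] ≤ 1 + χ`, `χ > 0`): `|Cov_π(A,B)| ≤ 2√χ·ab + 2(ℓ_A ε_m b + a ℓ_B ε_m)`. [ours] -/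
theorem truncatedFlow_abs_cov_boltzmann_le_two_sqrt_of_sqWeight (hn : n ≠ 0) (B : SuBasis n)
    (β : ℝ) (N : ℕ) {T : ℝ} (hT : 0 ≤ T) {Sk : ℕ → AmbConfig d L n → ℝ} {c : ℕ → ℝ}
    (hsm : ∀ k, ContDiff ℝ ∞ (Sk k)) (hser : IsLuscherSeries B (fun W => β * ambWilsonAction W) Sk c)
    {Φ : ℝ → GaugeConfig d L (Matrix.specialUnitaryGroup (Fin n) ℂ) →
      GaugeConfig d L (Matrix.specialUnitaryGroup (Fin n) ℂ)}
    (hΦ : IsFlowMap (fun t W => -linkGrad B (truncFlowAction Sk t N) W) Φ)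
    {t : ℝ} (ht : t ∈ Set.Icc 0 T) (hΦm : Measurable (Φ t))
    {S : GaugeConfig d L (Matrix.specialUnitaryGroup (Fin n) ℂ) → ℝ} (hS : Continuous S)
    {q w : GaugeConfig d L (Matrix.specialUnitaryGroup (Fin n) ℂ) → ℝ} (hq0 : ∀ U, 0 ≤ q U)
    (hqm : Measurable q)
    (hν : (trivialMeasure (Matrix.specialUnitaryGroup (Fin n) ℂ) d L).map (Φ t)
      = (trivialMeasure (Matrix.specialUnitaryGroup (Fin n) ℂ) d L).withDensity
          fun U => ENNReal.ofReal (q U))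
    (hw : ∀ U, Real.exp (-S U) / (partitionFn S).toReal = w U * q U)
    (hw2i : Integrable (fun U => w U ^ 2 * q U)
      (trivialMeasure (Matrix.specialUnitaryGroup (Fin n) ℂ) d L))
    {χ : ℝ}
    (hchi : ∫ U, w U ^ 2 * q U ∂(trivialMeasure (Matrix.specialUnitaryGroup (Fin n) ℂ) d L) ≤ 1 + χ)
    (hχ : 0 < χ) (m : ℕ) {A Bo : GaugeConfig d L (Matrix.specialUnitaryGroup (Fin n) ℂ) → ℝ}
    (hAm : Measurable A) (hBm : Measurable Bo) {a b : ℝ} (hAa : ∀ U, |A U| ≤ a)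
    (hBb : ∀ U, |Bo U| ≤ b) {SA SB : Set (Edge d L)} (hA : DependsOn A SA) (hB : DependsOn Bo SB)
    {ℓA ℓB : ℝ}
    (hAlip : ∀ (U U' : GaugeConfig d L (Matrix.specialUnitaryGroup (Fin n) ℂ)) (η : ℝ),
      (∀ e ∈ SA, ‖coeConfig U e - coeConfig U' e‖ ≤ η) → |A U - A U'| ≤ ℓA * η)
    (hBlip : ∀ (U U' : GaugeConfig d L (Matrix.specialUnitaryGroup (Fin n) ℂ)) (η : ℝ),
      (∀ e ∈ SB, ‖coeConfig U e - coeConfig U' e‖ ≤ η) → |Bo U - Bo U'| ≤ ℓB * η)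
    (hsep : ∀ e ∈ SA, ∀ e' ∈ SB,
      Disjoint (linkBall (2 * (N + 1) * m) e) (linkBall (2 * (N + 1) * m) e')) :
    |∫ U, A U * Bo U ∂(boltzmannMeasure S) -
        (∫ U, A U ∂(boltzmannMeasure S)) * ∫ U, Bo U ∂(boltzmannMeasure S)| ≤
      2 * Real.sqrt χ * (a * b) +
        2 * (ℓA * (2 * n * Real.exp (coneRate d n B β T N * t) *
            (coneRate d n B β T N * t) ^ m / (m ! : ℝ)) * b +
          a * (ℓB * (2 * n * Real.exp (coneRate d n B β T N * t) *
            (coneRate d n B β T N * t) ^ m / (m ! : ℝ)))) := by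
  obtain ⟨hp0, hpm, hpi, hp1⟩ := Gauge.density_boltzmann_spec (d := d) (L := L) hS
  obtain ⟨hqi, hq1⟩ := Gauge.integrable_of_map_eq_withDensity (d := d) (L := L) hΦm hq0 hqm hν
  haveI : IsProbabilityMeasure (boltzmannMeasure S) := by
    rw [Gauge.boltzmannMeasure_eq_withDensity hS]
    exact isProbabilityMeasure_withDensity_ofReal hp0 hpi hp1
  have hclose : IntegralClose (boltzmannMeasure S)
      ((trivialMeasure (Matrix.specialUnitaryGroup (Fin n) ℂ) d L).map (Φ t)) (Real.sqrt χ) := by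
    rw [Gauge.boltzmannMeasure_eq_withDensity hS, hν]
    unfold trivialMeasure at hpi hp1 hqi hq1 hw2i hchi ⊢
    exact integralClose_of_sqWeight_sqrt hp0 hpm hpi hp1 hq0 hqm hqi hq1 hw hw2i hchi hχ
  exact truncatedFlow_abs_cov_target_le_two hn B β N hT hsm hser hΦ ht hΦm m (boltzmannMeasure S)
    hclose hAm hBm hAa hBb hA hB hAlip hBlip hsep

end Flow

end Summit.Ventures.LatticeQCDFlow.TrivializingMaps

end
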